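import Summits.HubbardSuperconductivity.HubbardSuperconductivity.Theses.AposterioriCapRg
import Literature.Barriers.HubbardSuperconductivity.PureModelStripeCompetitionProofs
import Literature.MathematicalPhysics.QuantumLattice.HubbardModelParticleHoleProofs
import Literature.MathematicalPhysics.QuantumLattice.DopedRVBState

/-!
# Crux `SsbToEvenTorusLro` (item `stmt-HubbardSuperconductivity-1315`): the `S^z = 0` label is load-bearing and
odd particle numbers empty the sector

Support file of the standing disprover (generation 2; workfile `Cruxes/SsbToEvenTorusLro/Disproof.lean`, §4d–§4e),
second file after `MatrixClausesAndBox.lean`; the ferromagnetic half is `SaturatedFerromagnet.lean`. No definition is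
introduced: every statement is spelled out on the literal tree terms — the joint sectors `szSector N M` of the pure
Hubbard torus `hubbardTorus 2 L 1 U` and the summit's admissibility clause. Proved:

* `not_matrix_anySz` — with the `S^z` label of the admissibility clause FREE (ground states of any sector
  `(N_L, M_L)`), `d`-wave pair-field LRO along even sides is FALSE at every coupling and every `δ ≥ 0`: normalised
  ground states of the fully polarised sectors `(N_L, S^z = N_L/2)` exist (`N_L ≤ L²`, the tree's `two_mul_natFloor_le_sq`; `top_sector_groundState`,
  `exists_unit_isGroundStateInSector_top`, the tree's `sector_groundState` on Lieb's block `(N, 0)`) and every local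
  singlet pair operator annihilates a vector without down electrons (`localPair_mulVec_eq_zero_of_noDown`). Together
  with `MatrixClausesAndBox.lean`: all four data of the clause (number, normalisation, ground state, `S^z`) are used.
* `eq_zero_of_mem_szSector_zero_odd`, `matrix_oddNumber_trivial` — `szSector N 0 = ⊥` for odd `N`, so with an odd
  particle number the hypothesis class is empty and the matrix trivially true: the evenness of `N_L = 2⌊(1-δ)L²/2⌋` is
  what keeps the matrix contentful (guard for line stubs typed with a free `N : ℕ`).

Sources: E. H. Lieb, PRL 62 (1989) 1201 (sectors `(N↑, N↓)`, eq. (2)); H. Tasaki, Prog. Theor. Phys. 99 (1998) 489,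
§3.2 (the fully polarised sector is a free spinless band); D. J. Scalapino, Phys. Rep. 250 (1995) 329 §2 (pair field).
All statements are elementary bookkeeping.
-/

noncomputable section

namespace Summit.HubbardSuperconductivity.HubbardSuperconductivity.Theorems.SsbToEvenTorusLro.Negative

open Literature.MathematicalPhysics.QuantumLattice Literature.Barriers.HubbardSuperconductivity
open Literature.Probability.LatticeModels
open Filter Set Matrix HubbardWave0
open scoped ComplexOrder
open _root_.Topology
open Summit.HubbardSuperconductivity.HubbardSuperconductivity.Theses.AposterioriCapRg (SsbToEvenTorusLro)

/-! ### 1. Vectors without down electrons -/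

section NoDown

variable {Λ : Type*} [LinearOrder Λ] [Fintype Λ]

/-- Every down annihilator kills a vector supported on configurations without `↓` orbitals. [folklore] -/
theorem annihilation_down_mulVec_eq_zero {ψ : Fock (Orb Λ)} (h : ∀ (s : Finset (Orb Λ)) (y : Λ), orb y 1 ∈ s → ψ s = 0)
    (y : Λ) : annihilation (orb y 1) *ᵥ ψ = 0 := by
  funext s
  rw [annihilation_mulVec_apply, Pi.zero_apply]
  split_ifs with hy
  · rfl
  · rw [h (insert (orb y 1) s) y (Finset.mem_insert_self _ _), mul_zero]

/-- Annihilators preserve the absence of down electrons. [folklore] -/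
theorem annihilation_mulVec_noDown {ψ : Fock (Orb Λ)} (h : ∀ (s : Finset (Orb Λ)) (y : Λ), orb y 1 ∈ s → ψ s = 0)
    (i : Orb Λ) : ∀ (s : Finset (Orb Λ)) (y : Λ), orb y 1 ∈ s → (annihilation i *ᵥ ψ) s = 0 := by
  intro s y hy
  rw [annihilation_mulVec_apply]
  split_ifs with hi
  · rfl
  · rw [h (insert i s) y (Finset.mem_insert_of_mem hy), mul_zero]

/-- Membership in the fully polarised sector `(N, S^z = N/2)`: support on configurations with `N` up and no down
electrons (Lieb's sector `(N, 0)`). Lieb, PRL 62 (1989) 1201, eq. (2). [folklore] -/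
theorem mem_szSector_top_iff (N : ℕ) (ψ : Fock (Orb Λ)) :
    ψ ∈ szSector N ((N : ℝ) / 2) ↔ ∀ s, ¬((upPart s).card = N ∧ (downPart s).card = 0) → ψ s = 0 := by
  rw [mem_szSector_iff]
  constructor
  · rintro ⟨hN, hZ⟩ s hs
    by_cases hcard : s.card = N
    · by_contra hψ
      have h := congrFun hZ s
      rw [LiebThm1.spinZ_mulVec_apply, Pi.smul_apply, smul_eq_mul] at h
      have h' : (1 / 2 : ℂ) * (((upPart s).card : ℂ) - ((downPart s).card : ℂ)) = (((N : ℝ) / 2 : ℝ) : ℂ) :=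
        mul_right_cancel₀ hψ h
      have hre := congrArg Complex.re h'
      simp only [Complex.mul_re, Complex.sub_re, Complex.natCast_re, Complex.sub_im, Complex.natCast_im,
        sub_self, mul_zero, sub_zero, Complex.ofReal_re] at hre
      norm_num at hre
      have hsum : ((upPart s).card : ℝ) + ((downPart s).card : ℝ) = N := by
        rw [← Nat.cast_add, ← card_eq_upPart_add_downPart, hcard]
      have hd : ((downPart s).card : ℝ) = 0 := by linarith
      have hu : ((upPart s).card : ℝ) = N := by linarith
      exact hs ⟨by exact_mod_cast hu, by exact_mod_cast hd⟩
    · exact hN s hcard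
  · intro h
    refine ⟨fun s hs => h s fun hc => hs ?_, ?_⟩
    · rw [card_eq_upPart_add_downPart, hc.1, hc.2, add_zero]
    · funext s
      rw [LiebThm1.spinZ_mulVec_apply, Pi.smul_apply, smul_eq_mul]
      by_cases hc : (upPart s).card = N ∧ (downPart s).card = 0
      · rw [hc.1, hc.2]
        push_cast
        ring
      · rw [h s hc, mul_zero, mul_zero]

/-- Vectors of the fully polarised sector have no down electrons. [folklore] -/
theorem noDown_of_mem_szSector_top {N : ℕ} {ψ : Fock (Orb Λ)} (h : ψ ∈ szSector N ((N : ℝ) / 2)) :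
    ∀ (s : Finset (Orb Λ)) (y : Λ), orb y 1 ∈ s → ψ s = 0 := by
  intro s y hy
  refine (mem_szSector_top_iff N ψ).1 h s fun hc => ?_
  have hy' : y ∈ downPart s := (mem_downPart s y).2 hy
  rw [Finset.card_eq_zero] at hc
  simp [hc.2] at hy'

end NoDown

/-- **Every local singlet pair operator annihilates a vector with no down electrons** (each of its two terms ends in a
down annihilator, directly or after an up annihilator). Scalapino, Phys. Rep. 250 (1995) 329, §2 (the operator). [folklore] -/
theorem localPair_mulVec_eq_zero_of_noDown (g : Site 2 → ℝ) (L : ℕ) [NeZero L] (x : TorusSite 2 L)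
    {ψ : Fock (Orb (FermionTorus 2 L))} (h : ∀ (s : Finset (Orb (FermionTorus 2 L))) (y : FermionTorus 2 L),
      orb y 1 ∈ s → ψ s = 0) : localPair g L x *ᵥ ψ = 0 := by
  have h1 : ∀ a b : FermionTorus 2 L, (annihilation (orb a 0) * annihilation (orb b 1)) *ᵥ ψ = 0 :=
    fun a b => by rw [← mulVec_mulVec, annihilation_down_mulVec_eq_zero h, mulVec_zero]
  have h2 : ∀ a b : FermionTorus 2 L, (annihilation (orb a 1) * annihilation (orb b 0)) *ᵥ ψ = 0 :=
    fun a b => by rw [← mulVec_mulVec, annihilation_down_mulVec_eq_zero (annihilation_mulVec_noDown h _)]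
  simp only [localPair, sum_mulVec, smul_mulVec, sub_mulVec, h1, h2, sub_zero, smul_zero, Finset.sum_const_zero]

/-! ### 2. The fully polarised sector of the summit: ground states and the `S^z` label -/

/-- **The fully polarised sector** `(N, S^z = N/2)` of the pure Hubbard torus, `N ≤ L²`: a ground state exists and the
sector energy bounds `H` from below on it (Hermitian, block-diagonal in `(N↑, N↓)`; the block `(N, 0)` is the free
spinless band). Tasaki, Prog. Theor. Phys. 99 (1998) 489, §3.2 ("any state with `S_tot = S_max` does not feel the
on-site Coulomb repulsion"); Tasaki (2020) §2.2. [folklore] -/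
theorem top_sector_groundState (U : ℝ) (L N : ℕ) (hN : N ≤ L ^ 2) :
    (∃ v ∈ szSector N ((N : ℝ) / 2), v ≠ 0 ∧ hubbardTorus 2 L 1 U *ᵥ v =
        (((hubbardTorus 2 L 1 U).minEnergyOn (szSector N ((N : ℝ) / 2)) : ℝ) : ℂ) • v) ∧
      ∀ v ∈ szSector N ((N : ℝ) / 2), star v ⬝ᵥ v = 1 →
        (hubbardTorus 2 L 1 U).minEnergyOn (szSector N ((N : ℝ) / 2)) ≤ (star v ⬝ᵥ hubbardTorus 2 L 1 U *ᵥ v).re := by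
  classical
  have hcard : N ≤ Fintype.card (FermionTorus 2 L) := by
    simpa [FermionTorus, Fintype.card_fin] using hN
  obtain ⟨α₀, -, hα₀⟩ : ∃ α₀ : Finset (FermionTorus 2 L), α₀ ⊆ Finset.univ ∧ α₀.card = N :=
    Finset.exists_subset_card_eq (by rwa [Finset.card_univ])
  have hp : ∃ s : Finset (Orb (FermionTorus 2 L)), (upPart s).card = N ∧ (downPart s).card = 0 :=
    ⟨pairSet α₀ ∅, by rw [upPart_pairSet, hα₀], by rw [downPart_pairSet, Finset.card_empty]⟩
  have hinv : ∀ s s' : Finset (Orb (FermionTorus 2 L)), ¬((upPart s).card = N ∧ (downPart s).card = 0) →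
      ((upPart s').card = N ∧ (downPart s').card = 0) → hubbardTorus 2 L 1 U s s' = 0 := by
    intro s s' hs hs'
    by_contra hne
    have := LiebThm1.preservesSectors_hamiltonian (fermionTorusGraph 2 L) 1 U s s' hne
    exact hs ⟨this.1.trans hs'.1, this.2.trans hs'.2⟩
  exact sector_groundState (hubbardTorus 2 L 1 U) (LiebThm1.hamiltonian_isHermitian (fermionTorusGraph 2 L) 1 U)
    (fun s => (upPart s).card = N ∧ (downPart s).card = 0) hp hinv (szSector N ((N : ℝ) / 2))
    (mem_szSector_top_iff N)

/-- **Normalised ground states exist in the fully polarised sector** `(N, S^z = N/2)`, `N ≤ L²`. [folklore] -/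
theorem exists_unit_isGroundStateInSector_top (U : ℝ) (L N : ℕ) (hN : N ≤ L ^ 2) :
    ∃ ψ : Fock (Orb (FermionTorus 2 L)), star ψ ⬝ᵥ ψ = 1 ∧
      IsGroundStateInSector (hubbardTorus 2 L 1 U) N ((N : ℝ) / 2) ψ := by
  obtain ⟨⟨v, hv, hv0, hHv⟩, -⟩ := top_sector_groundState U L N hN
  obtain ⟨c, hc0, hc1⟩ := exists_smul_unit hv0
  exact ⟨c • v, hc1, isGroundStateInSector_smul ⟨hv, hv0, hHv⟩ hc0⟩

/-- **The `S^z = 0` label of the summit matrix is load-bearing, unconditionally.** With the spin label FREE (every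
normalised ground state of every sector `(N_L, M_L)`), `d`-wave pair-field LRO along even sides is FALSE at every
coupling `U` and every `δ ≥ 0`: the fully polarised sectors `(N_L, N_L/2)` have normalised ground states on every
torus and their singlet pair correlations vanish identically. [folklore] -/
theorem not_matrix_anySz (U : ℝ) {δ : ℝ} (hδ : 0 ≤ δ) :
    ¬ ∀ (N : ℕ → ℕ) (M : ℕ → ℝ) (ψ : ∀ L, Fock (Orb (FermionTorus 2 L))),
      (∀ L, Even L → N L = 2 * ⌊(1 - δ) * (L : ℝ) ^ 2 / 2⌋₊ ∧ star (ψ L) ⬝ᵥ ψ L = 1 ∧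
          IsGroundStateInSector (hubbardTorus 2 L 1 U) (N L) (M L) (ψ L)) →
        HasLongRangeOrder (fun k => halfOpenBox 2 (2 * k))
          (fun k => torusPullback (pairFieldCorr dWaveFormFactor ψ) (2 * k)) := by
  intro h
  have key : ∀ L : ℕ, ∃ φ : Fock (Orb (FermionTorus 2 L)), star φ ⬝ᵥ φ = 1 ∧
      IsGroundStateInSector (hubbardTorus 2 L 1 U) (2 * ⌊(1 - δ) * (L : ℝ) ^ 2 / 2⌋₊)
        (((2 * ⌊(1 - δ) * (L : ℝ) ^ 2 / 2⌋₊ : ℕ) : ℝ) / 2) φ :=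
    fun L => exists_unit_isGroundStateInSector_top U L _ (two_mul_natFloor_le_sq hδ L)
  choose φ hφ using key
  have hl := h (fun L => 2 * ⌊(1 - δ) * (L : ℝ) ^ 2 / 2⌋₊)
    (fun L => ((2 * ⌊(1 - δ) * (L : ℝ) ^ 2 / 2⌋₊ : ℕ) : ℝ) / 2) φ fun L _ => ⟨rfl, (hφ L).1, (hφ L).2⟩
  have hzero : ∀ (L : ℕ) (x y : TorusSite 2 L), pairFieldCorr dWaveFormFactor φ L x y = 0 := by
    intro L x y
    cases L with
    | zero => rfl
    | succ L =>
      rw [pairFieldCorr_succ, expect, ← mulVec_mulVec,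
        localPair_mulVec_eq_zero_of_noDown _ _ _ (noDown_of_mem_szSector_top (hφ (L + 1)).2.1),
        mulVec_zero, dotProduct_zero, Complex.zero_re]
  unfold HasLongRangeOrder at hl
  simp only [torusPullback_apply, hzero, Finset.sum_const_zero, zero_div, liminf_const] at hl
  exact lt_irrefl _ hl

/-! ### 3. Odd particle numbers empty the `S^z = 0` sector -/

section OddSector

variable {Λ : Type*} [LinearOrder Λ] [Fintype Λ]

/-- `szSector N 0 = ⊥` for odd `N`: a vector of the `S^z = 0` sector with an odd particle number vanishes
(`N = N↑ + N↓ = 2N↑`). Lieb, PRL 62 (1989) 1201, eq. (2). [folklore] -/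
theorem eq_zero_of_mem_szSector_zero_odd {N : ℕ} (hN : Odd N) {ψ : Fock (Orb Λ)} (h : ψ ∈ szSector N 0) :
    ψ = 0 := by
  rw [mem_szSector_iff] at h
  funext s
  by_cases hc : s.card = N
  · have h2 := congrFun h.2 s
    rw [LiebThm1.spinZ_mulVec_apply, Pi.smul_apply, smul_eq_mul, Complex.ofReal_zero, zero_mul] at h2
    rcases mul_eq_zero.1 h2 with h3 | h3
    · rcases mul_eq_zero.1 h3 with h4 | h4
      · norm_num at h4
      · have h5 : (upPart s).card = (downPart s).card := by exact_mod_cast sub_eq_zero.1 h4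
        exfalso
        refine Nat.not_even_iff_odd.2 hN ?_
        rw [← hc, card_eq_upPart_add_downPart, h5]
        exact ⟨_, rfl⟩
    · exact h3
  · exact h.1 s hc

/-- Hence no sector ground state exists at `(N, S^z = 0)` with `N` odd (the predicate asks `ψ ≠ 0`; the sector
energy `minEnergyOn _ ⊥ = sInf ∅ = 0` is a junk value). [folklore] -/
theorem not_isGroundStateInSector_zero_odd {N : ℕ} (hN : Odd N)
    (H : Matrix (Finset (Orb Λ)) (Finset (Orb Λ)) ℂ) (ψ : Fock (Orb Λ)) : ¬ IsGroundStateInSector H N 0 ψ :=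
  fun h => h.2.1 (eq_zero_of_mem_szSector_zero_odd hN h.1)

end OddSector

/-- **With an odd particle number the summit matrix is trivially TRUE** (empty hypothesis class at every even side,
already at `L = 0`): the parity built into `N_L = 2⌊(1-δ)L²/2⌋` is what keeps the matrix contentful. [folklore] -/
theorem matrix_oddNumber_trivial (U δ : ℝ) :
    ∀ (N : ℕ → ℕ) (ψ : ∀ L, Fock (Orb (FermionTorus 2 L))),
      (∀ L, Even L → N L = 2 * ⌊(1 - δ) * (L : ℝ) ^ 2 / 2⌋₊ + 1 ∧ star (ψ L) ⬝ᵥ ψ L = 1 ∧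
          IsGroundStateInSector (hubbardTorus 2 L 1 U) (N L) 0 (ψ L)) →
        HasLongRangeOrder (fun k => halfOpenBox 2 (2 * k))
          (fun k => torusPullback (pairFieldCorr dWaveFormFactor ψ) (2 * k)) := by
  intro N ψ hψ
  exfalso
  obtain ⟨hN, -, hgs⟩ := hψ 0 (by decide)
  exact not_isGroundStateInSector_zero_odd ⟨_, hN⟩ _ _ hgs

end Summit.HubbardSuperconductivity.HubbardSuperconductivity.Theorems.SsbToEvenTorusLro.Negative
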